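import Mathlib
import Literature.Analysis.FluidPDE.Axisymmetric
import Literature.Analysis.FluidPDE.KNSSNoAxisymmetricTypeIHolds
import Literature.Analysis.FluidPDE.KNSSTypeIRateRescaling
import Summits.NavierStokesRegularity.OSWSelfSimilar.TypeIIModulationDictionary
import Summits.NavierStokesRegularity.OSWSelfSimilar.TypeIIModulatedWeights
import HarnessLib
/-!
# `violates: V-T2 + V-CR` in template variables, composed with the tree's DISCHARGED K8
# (zone Z1 TEMPLATE §T1.2 (N4)/(N4′)/(N5), §T1.4-I (I-5 ii) — kernel kill forms)

HONEST FRAMING (cell ns-blowup GROUP B «PROFILE SEARCH», zone Z1 «Type-II log-modulated DSS ansatz for axisymmetric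
Navier–Stokes — the template IS the deliverable»; D-0035/D-0074): part VII of the Z1 dictionary. The Z1 census line reads
`violates: V-T2 (N4) + V-CR (I-5 ii)`: a genuine axisymmetric blow-up must defeat BOTH disjuncts of K8 =
`Literature.Analysis.FluidPDE.knss_no_axisymmetric_typeI` (KNSS 2009 Thms 6.1–6.2 / Seregin–Šverák 2009), which the tree
DISCHARGES (`Literature.Analysis.FluidPDE.knss_no_axisymmetric_typeI_holds`). Part I (`TypeIIModulationDictionary`) typed
V-T2 in gauge N-a against `IsTypeIBlowup` (TEMPLATE §T1.18 (K4): «V-CR is NOT in these files»). This file closes that gap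
and composes both disjuncts with the discharged theorem, so that each `violates:` token of the census is a kernel KILL FORM
ending in `HasSmoothExtensionPast` — by decl name, cited not restated:

* **V-CR has weight 0** (like the swirl, part V): for a centre `x*` on the axis, `r_{x* + λy} = |λ| r_y` (the tree's
  `Literature.Analysis.FluidPDE.cylRadius_axis_add_smul`) and `r_y ‖λ • u(x* + λy)‖ = r_x ‖u(x)‖` at `x = x* + λy`
  (`cylRadius_mul_norm_smul_comp_axisAffine`);
  hence the running-profile quantity `m_CR(τ) = sup_y r_y|V(y, τ)|` of TEMPLATE (N4′)/(D3′) is gauge-invariant and a bound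
  on it in ANY gauge is K8's second alternative verbatim (`profile_CR_bound_iff`).
* **Kill form V-CR** (`hasSmoothExtensionPast_of_profile_CR_bound`): under K8's standing hypotheses (classical on
  `[0, T)`, Leray–Hopf, bounded on every `[0, T']`, axisymmetric), if in SOME gauge `(λ(t) ≠ 0, x*(t) on the axis)` the
  rescaled profiles obey `r_y ‖V(y, τ(t))‖ ≤ C` for all `t < T`, then the solution extends smoothly past `T`.
* **Kill form V-T2** (`hasSmoothExtensionPast_of_forwardMean_ge`): under the same standing hypotheses, if a gauge
  `λ(t) > 0` with `‖u(t, ·)‖ ≤ λ(t)⁻¹` (gauge N-a) has forward-mean proxy `λ²/(2(T − t)) ≥ c > 0` near `T` (TEMPLATE (N2):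
  this quantity IS `ā(t)`, part I `forwardMean_eq`), then the solution extends smoothly past `T` (part I
  `isTypeIBlowup_of_forwardMean_ge` + K8's first alternative).
* **The census sentence** (`violates_VT2_and_VCR`): contrapositively, if `T` is NOT passed smoothly, then in every
  admissible gauge `liminf ā = 0` (for every `c > 0`, `λ²/(2(T−t)) < c` frequently as `t ↑ T`) AND `m_CR` is unbounded on
  the running profiles (for every `C` some `t < T`, `y` with `C < r_y‖V(y, τ(t))‖`).

**Nothing here asserts that any Navier–Stokes solution blows up**: these are NECESSARY conditions for blow-up obtained by
composing a discharged regularity theorem with exact changes of variables. «violates: n/a — dictionary» (the file STATES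
the `violates:` tokens; it is not a candidate); bears_on LADDER-NS N5/Z1 → N1 linear core / N0⁻.
Author: ns-blowup-profile-eng-1 g5, 2026-08-27.
-/

open Real Filter Topology Set InnerProductSpace
open scoped RealInnerProductSpace
open Literature.Analysis.FluidPDE

namespace Summit.NavierStokesRegularity.OSWSelfSimilar
namespace TypeIIModulationDictionary

/-! ### 1. `r|u|` has weight 0 -/

section WeightZero

/-- **`r|u|` has weight 0** (TEMPLATE (N4′): `sup_x r_x|u(x, t)| = sup_y r_y|V(y, τ)|`): for `x*` on the axis and
`V(y) = λ • u(x* + λ • y)`, `r_y ‖V(y)‖ = r_x ‖u(x)‖` at `x = x* + λ • y` (any `λ`). [new here — dictionary] -/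
theorem cylRadius_mul_norm_smul_comp_axisAffine (u : EuclideanSpace ℝ (Fin 3) → EuclideanSpace ℝ (Fin 3))
    {xc : EuclideanSpace ℝ (Fin 3)} (hxc0 : xc 0 = 0) (hxc1 : xc 1 = 0) (lam : ℝ) (y : EuclideanSpace ℝ (Fin 3)) :
    cylRadius y * ‖lam • u (xc + lam • y)‖ = cylRadius (xc + lam • y) * ‖u (xc + lam • y)‖ := by
  rw [norm_smul, Real.norm_eq_abs, cylRadius_axis_add_smul hxc0 hxc1 lam y]
  ring

/-- **A bound on `m_CR` in any gauge IS K8's second alternative** (TEMPLATE (N4′)/(I-5 ii)): for `λ ≠ 0` and `x*` on the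
axis, `(∀ y, r_y ‖λ • u(x* + λy)‖ ≤ C) ↔ (∀ x, r_x ‖u(x)‖ ≤ C)` (the dilation `y ↦ x* + λy` is onto).
[new here — dictionary] -/
theorem profile_CR_bound_iff (u : EuclideanSpace ℝ (Fin 3) → EuclideanSpace ℝ (Fin 3))
    {xc : EuclideanSpace ℝ (Fin 3)} (hxc0 : xc 0 = 0) (hxc1 : xc 1 = 0) {lam : ℝ} (hlam : lam ≠ 0) (C : ℝ) :
    (∀ y, cylRadius y * ‖lam • u (xc + lam • y)‖ ≤ C) ↔ ∀ x, cylRadius x * ‖u x‖ ≤ C := by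
  constructor
  · intro h x
    have hx : xc + lam • (lam⁻¹ • (x - xc)) = x := by
      rw [smul_smul, mul_inv_cancel₀ hlam, one_smul, add_sub_cancel]
    have := h (lam⁻¹ • (x - xc))
    rwa [cylRadius_mul_norm_smul_comp_axisAffine u hxc0 hxc1, hx] at this
  · intro h y
    rw [cylRadius_mul_norm_smul_comp_axisAffine u hxc0 hxc1]
    exact h _

end WeightZero

/-! ### 2. The two K8 disjuncts as kill forms in template variables -/

section KillForms

variable {ν T : ℝ} {u : ℝ → EuclideanSpace ℝ (Fin 3) → EuclideanSpace ℝ (Fin 3)}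
  {p : ℝ → EuclideanSpace ℝ (Fin 3) → ℝ}

/-- **Kill form V-CR** (TEMPLATE (N4′)/(I-5 ii) composed with the DISCHARGED K8,
`Literature.Analysis.FluidPDE.knss_no_axisymmetric_typeI_holds`, second alternative). Let `(u, p)` be a classical solution
of Navier–Stokes (`ν > 0`, `f = 0`) on `ℝ³ × [0, T)`, Leray–Hopf on `[0, T)`, bounded on every `ℝ³ × [0, T']`, `T' < T`,
and axisymmetric (K8's standing hypotheses, verbatim). If in SOME gauge — any scale function `λ(t) ≠ 0` and any centre
`x*(t)` on the axis — the rescaled profiles `V(τ(t), y) = λ(t) • u(t, x*(t) + λ(t) • y)` satisfy `r_y ‖V‖ ≤ C` for all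
`t ∈ [0, T)` and all `y`, then `u` extends as a classical solution past `T`: `m_CR` bounded kills the scenario.
[new here — dictionary] -/
theorem hasSmoothExtensionPast_of_profile_CR_bound (hν : 0 < ν) (hT : 0 < T)
    (h : IsClassicalNSSolutionOn (Ico 0 T) ν 0 u p) (hLH : IsLerayHopfOn T ν 0 (u 0) u)
    (hbdd : ∀ T' < T, ∃ M : ℝ, ∀ t ∈ Icc 0 T', ∀ x, ‖u t x‖ ≤ M)
    (haxi : ∀ t ∈ Ico 0 T, IsAxisymmetric (u t))
    {lam : ℝ → ℝ} {xc : ℝ → EuclideanSpace ℝ (Fin 3)} (hlam : ∀ t ∈ Ico 0 T, lam t ≠ 0)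
    (hxc : ∀ t ∈ Ico 0 T, xc t 0 = 0 ∧ xc t 1 = 0)
    (hCR : ∃ C : ℝ, ∀ t ∈ Ico 0 T, ∀ y, cylRadius y * ‖lam t • u t (xc t + lam t • y)‖ ≤ C) :
    HasSmoothExtensionPast ν 0 u T := by
  obtain ⟨C, hC⟩ := hCR
  refine knss_no_axisymmetric_typeI_holds hν hT h hLH hbdd haxi (Or.inr ⟨C, fun t ht x => ?_⟩)
  exact (profile_CR_bound_iff (u t) (hxc t ht).1 (hxc t ht).2 (hlam t ht) C).1 (hC t ht) x

/-- **Kill form V-T2** (TEMPLATE (N4)/(N5) in gauge N-a composed with the DISCHARGED K8, first alternative). Same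
standing hypotheses; let `λ(t) > 0` be a gauge with `‖u(t, x)‖ ≤ λ(t)⁻¹` for `t` near `T` (gauge N-a: `λ = 1/‖u(t)‖_∞`) whose
forward-mean proxy `λ(t)²/(2(T − t))` — which IS the forward mean `ā(t)` of the modulation by TEMPLATE (N2) / part I
`forwardMean_eq` — stays `≥ c > 0` near `T`. Then `u` extends as a classical solution past `T` (part I
`isTypeIBlowup_of_forwardMean_ge` gives `IsTypeIBlowup u T`; K8 does the rest): `liminf ā > 0` kills the scenario.
[new here — dictionary] -/
theorem hasSmoothExtensionPast_of_forwardMean_ge (hν : 0 < ν) (hT : 0 < T)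
    (h : IsClassicalNSSolutionOn (Ico 0 T) ν 0 u p) (hLH : IsLerayHopfOn T ν 0 (u 0) u)
    (hbdd : ∀ T' < T, ∃ M : ℝ, ∀ t ∈ Icc 0 T', ∀ x, ‖u t x‖ ≤ M)
    (haxi : ∀ t ∈ Ico 0 T, IsAxisymmetric (u t))
    {lam : ℝ → ℝ} {c : ℝ} (hc : 0 < c) (hlam : ∀ᶠ t in 𝓝[<] T, 0 < lam t)
    (hbound : ∀ᶠ t in 𝓝[<] T, ∀ x, ‖u t x‖ ≤ (lam t)⁻¹)
    (hmean : ∀ᶠ t in 𝓝[<] T, c ≤ lam t ^ 2 / (2 * (T - t))) :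
    HasSmoothExtensionPast ν 0 u T :=
  knss_no_axisymmetric_typeI_holds hν hT h hLH hbdd haxi
    (Or.inl (isTypeIBlowup_of_forwardMean_ge hc hlam hbound hmean))

/-- **The Z1 census sentence `violates: V-T2 (N4) + V-CR (I-5 ii)`, kernel form.** Under K8's standing hypotheses, if the
solution does NOT extend smoothly past `T`, then (V-T2) for every gauge `λ(t) > 0` with `‖u(t, ·)‖ ≤ λ(t)⁻¹` near `T` and
every `c > 0`, `λ²/(2(T − t)) < c` frequently as `t ↑ T` (`liminf ā = 0`: NOT Type I), AND (V-CR) for every gauge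
`(λ(t) ≠ 0, x*(t) on the axis)` and every `C`, some running profile has `C < r_y ‖V(y, τ(t))‖` (`m_CR` unbounded).
[new here — dictionary] -/
theorem violates_VT2_and_VCR (hν : 0 < ν) (hT : 0 < T)
    (h : IsClassicalNSSolutionOn (Ico 0 T) ν 0 u p) (hLH : IsLerayHopfOn T ν 0 (u 0) u)
    (hbdd : ∀ T' < T, ∃ M : ℝ, ∀ t ∈ Icc 0 T', ∀ x, ‖u t x‖ ≤ M)
    (haxi : ∀ t ∈ Ico 0 T, IsAxisymmetric (u t)) (hblow : ¬ HasSmoothExtensionPast ν 0 u T) :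
    (∀ {lam : ℝ → ℝ}, (∀ᶠ t in 𝓝[<] T, 0 < lam t) → (∀ᶠ t in 𝓝[<] T, ∀ x, ‖u t x‖ ≤ (lam t)⁻¹) →
        ∀ c : ℝ, 0 < c → ∃ᶠ t in 𝓝[<] T, lam t ^ 2 / (2 * (T - t)) < c) ∧
    (∀ {lam : ℝ → ℝ} {xc : ℝ → EuclideanSpace ℝ (Fin 3)}, (∀ t ∈ Ico 0 T, lam t ≠ 0) →
        (∀ t ∈ Ico 0 T, xc t 0 = 0 ∧ xc t 1 = 0) →
        ∀ C : ℝ, ∃ t ∈ Ico 0 T, ∃ y, C < cylRadius y * ‖lam t • u t (xc t + lam t • y)‖) := by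
  refine ⟨fun {lam} hlam hbound c hc => ?_, fun {lam} {xc} hlam hxc C => ?_⟩
  · -- V-T2: otherwise `ā ≥ c` eventually and the V-T2 kill form applies
    by_contra hnot
    rw [Filter.not_frequently] at hnot
    have hmean : ∀ᶠ t in 𝓝[<] T, c ≤ lam t ^ 2 / (2 * (T - t)) := by
      filter_upwards [hnot] with t ht using not_lt.mp ht
    exact hblow (hasSmoothExtensionPast_of_forwardMean_ge hν hT h hLH hbdd haxi hc hlam hbound hmean)
  · -- V-CR: otherwise `m_CR ≤ C` throughout and the V-CR kill form applies
    by_contra hnot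
    push Not at hnot
    exact hblow (hasSmoothExtensionPast_of_profile_CR_bound hν hT h hLH hbdd haxi hlam hxc ⟨C, hnot⟩)

end KillForms

end TypeIIModulationDictionary
end Summit.NavierStokesRegularity.OSWSelfSimilar
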